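import Mathlib
import Literature.Combinatorics.Additive.TripleProductProperty
import Summits.MatrixMultiplication.MatrixMultiplication.Theses.SnSubsetDichotomy

/-!
# Sketch — crux-ideate stmt-MatrixMultiplication-8303 (GlobalBranch), ideator 2, round 1

First lemmas of the three idea cards (they must elaborate; proofs are not required at this stage,
but the two elementary ones are proved to certify that they are M-sized and true).

* Card α `template-exclusion-two-thirds`: `templateExclusion` (the 2/3-lemma) and the reduction
  target `TemplateCompleteness`.
* Card β `coset-descent-confinement`: `cosetDescent`, `tpp_conj_translate`, `ConfinedPacking`.
* Card γ `delsarte-tpp-codes`: `DelsarteTPPBound` (dual certificate inequality).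
-/

set_option linter.dupNamespace false

namespace Summit.MatrixMultiplication.MatrixMultiplication.Cruxes.GlobalBranch.Sketch

open Finset
open Literature.Combinatorics.Additive

section General

variable {G : Type*} [Group G] [DecidableEq G]

/-! ### Card α — template exclusion (the 2/3-lemma) -/

/-- **Template exclusion (2/3-lemma).** For any three finite sets `S T U` of a group and any
product-free *template* `(A₀, B₀, C₀)` (no `a ∈ A₀`, `b ∈ B₀` with `a * b ∈ C₀`), the three
"capture fractions" of the quotient pairs — the proportion of `(s,t) ∈ S × T` with `s⁻¹ t ∈ A₀`, of
`(t,u)` with `t⁻¹ u ∈ B₀`, of `(s,u)` with `s⁻¹ u ∈ C₀` — sum to at most `2`, because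
`s⁻¹ u = (s⁻¹ t)(t⁻¹ u)` identically, so the three events never hold simultaneously for one
`(s,t,u)`. Stated multiplied out (no divisions): with `a, b, c` the three counts,
`a·|U| + b·|S| + c·|T| ≤ 2·|S||T||U|`. -/
theorem templateExclusion (S T U A₀ B₀ C₀ : Finset G)
    (hfree : ∀ a ∈ A₀, ∀ b ∈ B₀, a * b ∉ C₀) :
    ((S ×ˢ T).filter (fun p => p.1⁻¹ * p.2 ∈ A₀)).card * U.card
      + ((T ×ˢ U).filter (fun p => p.1⁻¹ * p.2 ∈ B₀)).card * S.card
      + ((S ×ˢ U).filter (fun p => p.1⁻¹ * p.2 ∈ C₀)).card * T.card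
      ≤ 2 * (S.card * T.card * U.card) := by
  classical
  -- work on the product S × T × U and count, per triple, how many of the three events hold (≤ 2)
  set X := S ×ˢ T ×ˢ U with hX
  have key : ∀ p ∈ X,
      (if p.1⁻¹ * p.2.1 ∈ A₀ then 1 else 0) + (if p.2.1⁻¹ * p.2.2 ∈ B₀ then 1 else 0)
        + (if p.1⁻¹ * p.2.2 ∈ C₀ then 1 else 0) ≤ (2 : ℕ) := by
    intro p _
    by_cases h1 : p.1⁻¹ * p.2.1 ∈ A₀ <;> by_cases h2 : p.2.1⁻¹ * p.2.2 ∈ B₀ <;>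
      by_cases h3 : p.1⁻¹ * p.2.2 ∈ C₀ <;> simp [h1, h2, h3]
    have := hfree _ h1 _ h2
    apply this
    have : p.1⁻¹ * p.2.1 * (p.2.1⁻¹ * p.2.2) = p.1⁻¹ * p.2.2 := by group
    rw [this]; exact h3
  have hsum := Finset.sum_le_sum key
  simp only [Finset.sum_add_distrib, Finset.sum_const, smul_eq_mul] at hsum
  -- identify the three sums with the three counts
  have e1 : (∑ p ∈ X, if p.1⁻¹ * p.2.1 ∈ A₀ then 1 else 0)
      = ((S ×ˢ T).filter (fun p => p.1⁻¹ * p.2 ∈ A₀)).card * U.card := by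
    rw [hX, Finset.card_filter]
    rw [show S ×ˢ T ×ˢ U = (S ×ˢ T ×ˢ U) from rfl]
    rw [Finset.sum_product (s := S) (t := T ×ˢ U), Finset.sum_product (s := S) (t := T)]
    rw [Finset.sum_mul]
    refine Finset.sum_congr rfl fun s _ => ?_
    rw [Finset.sum_product, Finset.sum_mul]
    refine Finset.sum_congr rfl fun t _ => ?_
    by_cases hc : s⁻¹ * t ∈ A₀ <;> simp [hc]
  have e2 : (∑ p ∈ X, if p.2.1⁻¹ * p.2.2 ∈ B₀ then 1 else 0)
      = ((T ×ˢ U).filter (fun p => p.1⁻¹ * p.2 ∈ B₀)).card * S.card := by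
    rw [hX, Finset.card_filter, Finset.sum_product (s := S) (t := T ×ˢ U)]
    simp [Finset.sum_const, mul_comm]
  have e3 : (∑ p ∈ X, if p.1⁻¹ * p.2.2 ∈ C₀ then 1 else 0)
      = ((S ×ˢ U).filter (fun p => p.1⁻¹ * p.2 ∈ C₀)).card * T.card := by
    rw [hX, Finset.card_filter, Finset.sum_product (s := S) (t := T ×ˢ U),
      Finset.sum_product (s := S) (t := U), Finset.sum_mul]
    refine Finset.sum_congr rfl fun s _ => ?_
    rw [Finset.sum_product, Finset.sum_comm, Finset.sum_mul]
    refine Finset.sum_congr rfl fun u _ => ?_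
    by_cases hc : s⁻¹ * u ∈ C₀ <;> simp [hc]
  have hcard : X.card = S.card * T.card * U.card := by
    rw [hX, Finset.card_product, Finset.card_product, mul_assoc]
  rw [e1, e2, e3, hcard] at hsum
  linarith

/-! ### Card β — coset descent and confinement -/

omit [DecidableEq G] in
/-- **Coset descent.** If the quotient set `S⁻¹U` lies in ONE left coset `gY` of a subgroup `Y`,
then after an admissible transformation (`(S,T,U) ↦ (xSy₁, xTy₂, xUy₃)` preserves the TPP, see
`tpp_conj_translate`) both `S` and `U` lie in `Y`: take `x = u₀⁻¹`, `y₁ = g`, `y₃ = 1`. -/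
theorem cosetDescent (S U : Finset G) (Y : Subgroup G) (g : G) (hU : U.Nonempty)
    (hS : S.Nonempty)
    (h : ∀ s ∈ S, ∀ u ∈ U, ∃ y ∈ Y, s⁻¹ * u = g * y) :
    ∃ x y₁ y₃ : G, (∀ s ∈ S, x * s * y₁ ∈ Y) ∧ (∀ u ∈ U, x * u * y₃ ∈ Y) := by
  obtain ⟨u₀, hu₀⟩ := hU
  obtain ⟨s₀, hs₀⟩ := hS
  refine ⟨u₀⁻¹, g, 1, fun s hs => ?_, fun u hu => ?_⟩
  · obtain ⟨y, hy, hsy⟩ := h s hs u₀ hu₀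
    have : u₀⁻¹ * s * g = y⁻¹ := by
      have h1 : u₀ = s * (g * y) := by rw [← hsy]; group
      rw [h1]; group
    rw [this]; exact Y.inv_mem hy
  · obtain ⟨y₀, hy₀, h₀⟩ := h s₀ hs₀ u₀ hu₀
    obtain ⟨y, hy, h₁⟩ := h s₀ hs₀ u hu
    have : u₀⁻¹ * u * 1 = y₀⁻¹ * y := by
      have e₀ : u₀ = s₀ * (g * y₀) := by rw [← h₀]; group
      have e₁ : u = s₀ * (g * y) := by rw [← h₁]; group
      rw [e₀, e₁]; group
    rw [this]; exact Y.mul_mem (Y.inv_mem hy₀) hy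

/-- **Admissible transformations.** The TPP is invariant under `(S,T,U) ↦ (xSy₁, xTy₂, xUy₃)`
(same left factor, arbitrary right factors): the quotient sets are conjugated by `x`. -/
theorem tpp_conj_translate (S T U : Finset G) (x y₁ y₂ y₃ : G)
    (h : TripleProductProperty S T U) :
    TripleProductProperty (S.image fun s => x * s * y₁) (T.image fun t => x * t * y₂)
      (U.image fun u => x * u * y₃) := by
  intro s hs s' hs' t ht t' ht' u hu u' hu' hprod
  simp only [Finset.mem_image] at hs hs' ht ht' hu hu'
  obtain ⟨a, ha, rfl⟩ := hs; obtain ⟨a', ha', rfl⟩ := hs'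
  obtain ⟨b, hb, rfl⟩ := ht; obtain ⟨b', hb', rfl⟩ := ht'
  obtain ⟨c, hc, rfl⟩ := hu; obtain ⟨c', hc', rfl⟩ := hu'
  have key : a * a'⁻¹ * (b * b'⁻¹) * (c * c'⁻¹) = 1 := by
    have e : x * a * y₁ * (x * a' * y₁)⁻¹ * (x * b * y₂ * (x * b' * y₂)⁻¹)
        * (x * c * y₃ * (x * c' * y₃)⁻¹) = x * (a * a'⁻¹ * (b * b'⁻¹) * (c * c'⁻¹)) * x⁻¹ := by
      group
    rw [e] at hprod
    have : a * a'⁻¹ * (b * b'⁻¹) * (c * c'⁻¹) = x⁻¹ * (x * (a * a'⁻¹ * (b * b'⁻¹) * (c * c'⁻¹)) * x⁻¹) * x := by group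
    rw [this, hprod]; group
  obtain ⟨h1, h2, h3⟩ := h a ha a' ha' b hb b' hb' c hc c' hc' key
  subst h1; subst h2; subst h3
  exact ⟨rfl, rfl, rfl⟩

/-- **Confined packing** (statement): a TPP triple lying inside a subgroup `Y` has
`(|S||T||U|)² ≤ |Y|³` (pairwise packing `|S||T| ≤ |Y|` inside `Y`, three times). Combined with
`cosetDescent` this is the exit "confinement ⟹ sub-threshold by the index":
`N ≤ |Y|^{3/2} = (n!)^{3/2} [Sₙ:Y]^{-3/2}`. -/
def ConfinedPacking : Prop :=
  ∀ (G : Type) [Group G] [DecidableEq G] (Y : Subgroup G) [Fintype Y] (S T U : Finset G),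
    (∀ s ∈ S, s ∈ Y) → (∀ t ∈ T, t ∈ Y) → (∀ u ∈ U, u ∈ Y) → TripleProductProperty S T U →
      (S.card * T.card * U.card) ^ 2 ≤ (Fintype.card Y) ^ 3

/-! ### Card γ — Delsarte / dual certificate for TPP codes -/

/-- The right quotient set `Q(X) = {x x'⁻¹}`. -/
def quot (X : Finset G) : Finset G := Finset.image₂ (fun x x' => x * x'⁻¹) X X

/-- **Delsarte bound for TPP codes** (statement of the dual certificate). If `(S,T,U)` has the TPP
then `Q(S) ∖ {1}` avoids `Z := Q(U)Q(T) ∪ Q(T)Q(U)`; hence for every real class of "positive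
definite" `φ : G → ℝ` (the matrix `(φ(g⁻¹h))_{g,h}` is positive semidefinite) that is `≤ 0` off
`Z ∪ {1}`, one has `|S| · Σ_g φ(g) ≤ |G| · φ(1)`. The packing bound `|S| ≤ |G|/|U|` is the witness
`φ = 1_U ⋆ 1_{U⁻¹} / |U|`; the lever is to build witnesses using BOTH `U` and `T`. -/
def DelsarteTPPBound : Prop :=
  ∀ (G : Type) [Group G] [Fintype G] [DecidableEq G] (S T U : Finset G) (φ : G → ℝ),
    TripleProductProperty S T U →
    (Matrix.of fun g h : G => φ (g⁻¹ * h)).PosSemidef →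
    (∀ g : G, g ≠ 1 → g ∉ Finset.image₂ (· * ·) (quot U) (quot T) →
        g ∉ Finset.image₂ (· * ·) (quot T) (quot U) → φ g ≤ 0) →
      (S.card : ℝ) * ∑ g, φ g ≤ (Fintype.card G : ℝ) * φ 1

/-! ### By-product (barrier note (c)): the Hölder–Schatten frame inequality, any finite group -/

/-- **Frame inequality** (statement; sharpens BCGPU 2023 Cor. 3.5 by a factor 2 in the balanced
case): for a TPP triple with `N = |S||T||U| > |G|`,
`∏_{pairs} (|G|/(|Xᵢ||Xⱼ|) − 1) ≥ (1 − |G|/N)³`. Proof sketch: normalised Fourier identity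
`Σ_{λ≠1} d_λ tr(Π^SΠ^TΠ^U) = −(1 − |G|/N)`, `Σ_{λ≠1} d_λ tr(Π^XΠ^Y) = |G|/(|X||Y|) − 1`,
`|tr(Π₁Π₂Π₃)| ≤ ∏ tr(ΠᵢΠⱼ)^{1/3}` (Schatten-3 Hölder, `‖Πᵢ‖ ≤ 1`), then Hölder over `λ`. -/
def FrameInequality : Prop :=
  ∀ (G : Type) [Group G] [Fintype G] [DecidableEq G] (S T U : Finset G),
    TripleProductProperty S T U → (Fintype.card G : ℝ) < S.card * T.card * U.card →
      (1 - (Fintype.card G : ℝ) / (S.card * T.card * U.card)) ^ 3 ≤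
        ((Fintype.card G : ℝ) / (S.card * T.card) - 1) * ((Fintype.card G : ℝ) / (T.card * U.card) - 1)
          * ((Fintype.card G : ℝ) / (U.card * S.card) - 1)

end General

/-! ### The reduction target of card α inside `S_n` -/

/-- Bump-freeness at scale `n^{(1/2+ε)t}` up to level `√n` (verbatim the hypothesis of the crux
`GlobalBranch`, for one set). -/
def BumpFree (ε : ℝ) (n : ℕ) (X : Finset (Equiv.Perm (Fin n))) : Prop :=
  ∀ t : ℕ, 1 ≤ t → (t : ℝ) ≤ Real.sqrt (n : ℝ) → ∀ I L : Fin t → Fin n, Function.Injective I →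
    Function.Injective L →
      ((X.filter (fun σ => ∀ k, σ (I k) = L k)).card : ℝ) * (n.descFactorial t : ℝ) ≤
        (n : ℝ) ^ ((1 / 2 + ε) * t) * (X.card : ℝ)

/-- **Template completeness (INV-T)** — the inverse theorem card α reduces `GlobalBranch` to:
bump-free triples `(A,B,C)` in `S_n` with `|A||B||C| ≥ (n!)³ e^{−2c√n}` that are near-product-free
(at most `(n!)^{-1/4}` times the mean number `|A||B||C|/n!` of solutions of `a·b = c` — quotient triples
of threshold TPP triples have ratio `n!/N ≈ (n!)^{-1/2}`; the KL23 §7 block sets, ratio `e^{-Θ(n^{1/4})}`,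
are deliberately outside) are `>2/3`-captured by some product-free template. With `templateExclusion` and the bookkeeping (quotient triples of bump-free TPP triples
are bump-free, full-size, and have `N ≤ N²/(2·n!)` solutions) this implies the crux. -/
def TemplateCompleteness : Prop :=
  ∃ ε : ℝ, 0 < ε ∧ ∃ c : ℝ, 0 < c ∧ ∃ n₀ : ℕ, ∀ n ≥ n₀, ∀ A B C : Finset (Equiv.Perm (Fin n)),
    BumpFree ε n A → BumpFree ε n B → BumpFree ε n C →
    (n.factorial : ℝ) ^ (3 : ℕ) * Real.exp (-(2 * c * Real.sqrt (n : ℝ))) ≤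
        ((A.card * B.card * C.card : ℕ) : ℝ) →
    (n.factorial : ℝ) ^ ((5 : ℝ) / 4) * (((A ×ˢ B).filter (fun p => p.1 * p.2 ∈ C)).card : ℝ) ≤
        ((A.card * B.card * C.card : ℕ) : ℝ) →
      ∃ A₀ B₀ C₀ : Finset (Equiv.Perm (Fin n)), (∀ a ∈ A₀, ∀ b ∈ B₀, a * b ∉ C₀) ∧
        2 * ((A.card * B.card * C.card : ℕ) : ℝ) <
          ((A ∩ A₀).card : ℝ) * (B.card * C.card) + ((B ∩ B₀).card : ℝ) * (A.card * C.card)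
            + ((C ∩ C₀).card : ℝ) * (A.card * B.card)

/-- The crux, by name (the cards' lines must conclude this). -/
example : Prop := Summit.MatrixMultiplication.MatrixMultiplication.Theses.SnSubsetDichotomy.GlobalBranch

end Summit.MatrixMultiplication.MatrixMultiplication.Cruxes.GlobalBranch.Sketch
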